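import Mathlib
import Literature.Probability.LatticeModels.GKSInequalities
import Summits.CriticalPhenomena.Ising3DConformalLimit.Theorems.PrecisionLaplacianMoebiusLimitOfTwoPointLawCondCubicNonpos
import Summits.CriticalPhenomena.Ising3DConformalLimit.Theorems.PrecisionLaplacianInverseMFerromagnetContractionConditioning
import HarnessLib

/-!
# Crux `PrecisionLaplacian.InverseMFerromagnet` (stmt-CriticalPhenomena-4798), line `Sketch` —
# stub `helper_twoClamp_secondDiff_nonpos` (K2: with two spins clamped to `+1`, the conditional
# magnetisation has a nonpositive second difference in two further boundary spins)

THEOREM-ONLY file (no definitions).  Spin system `ν_{Λ;K}` on `Fin n` (`w = gksWeight univ K C`,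
`K ≥ 0`, supports `|C b| ≤ 2`: pair ferromagnet with nonnegative fields) and sites `g, i, j, k, l`.
With the restricted sums `Z_{st} = ∑_σ 1[σ_i = σ_j = 1, σ_k = s, σ_l = t] w(σ)` and
`N_{st} = ∑_σ 1[σ_i = σ_j = 1, σ_k = s, σ_l = t] σ_g w(σ)`,

  `N_{++} Z_{--} Z_{+-} Z_{-+} + Z_{++} N_{--} Z_{+-} Z_{-+} ≤ Z_{++} Z_{--} N_{+-} Z_{-+} + Z_{++} Z_{--} Z_{+-} N_{-+}`,

i.e. `m(+,+,+,+) + m(+,+,-,-) ≤ m(+,+,+,-) + m(+,+,-,+)` for the conditional magnetisation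
`m(s) = ⟨σ_g | (σ_i,σ_j,σ_k,σ_l) = s⟩` (THEOREM `helper_twoClamp_secondDiff_nonpos`).

PROOF.  Reduction to the one-clamp theorem `stub_condCubicNonpos` (module `…CondCubicNonpos`, the
same statement with the single clamp `σ_p = 1`).
* `j = i`: the statement is `stub_condCubicNonpos` with `p = i` (`a ∧ a ∧ b ↔ a ∧ b`).
* `j = k` (resp. `j = l`): the restricted sums with `s = -1` (resp. `t = -1`) are empty, and both sides
  vanish.
* `j = g`: on the clamp `σ_g = 1`, so `N_{st} = Z_{st}` and the two sides are equal.
* `j ∉ {i, k, l, g}`: PIN the spin at `j`.  Let `C' b = (C b).erase j` (same couplings; the bonds at `j`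
  become fields at the other endpoint, the fields at `j` become constants) and `ω⁺ = update ω j 1`.
  Then `w'(ω) = w(ω⁺)` (`tcs_gksWeight_erase`), and the lift `ω ↦ ω⁺` is two-to-one onto `{σ_j = 1}`:
  `∑_ω G(ω⁺) = ∑_ω (1 + σ_j) G(ω)` (`tcs_sum_update`, by the flip at `j`).  Hence for every observable
  `F` not depending on `σ_j`, `∑_σ F w' = 2 ∑_σ 1[σ_j = 1] F w` (`tcs_gksSum_erase_lift`): the one-clamp
  restricted sums of `(K, C')` at `(p,q,r) = (i,k,l)` are twice the two-clamp restricted sums of `(K, C)`.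
  `stub_condCubicNonpos` for `(K, C')` (still `K ≥ 0`, `|C' b| ≤ |C b| ≤ 2`) is `2⁴ ×` the claim.
-/

namespace Summit.CriticalPhenomena.Ising3DConformalLimit.Cruxes.InverseMFerromagnet.PartialCovarianceLadder

open Literature.Probability.LatticeModels Finset Matrix

noncomputable section

/-! ## Pinning the spin at `j`: the lift `ω ↦ update ω j 1` -/

/-- The pinned lift `ω ↦ update ω j 1` does not see the spin at `j`: it is unchanged by the flip at
`j`. [folklore] -/
theorem tcs_update_flip {n : ℕ} (j : Fin n) (ω : SpinConfig (Fin n)) :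
    Function.update (fun z => if z = j then -ω z else ω z) j 1 = Function.update ω j 1 := by
  funext z
  by_cases hz : z = j
  · subst hz
    rw [Function.update_self, Function.update_self]
  · rw [Function.update_of_ne hz, Function.update_of_ne hz, if_neg hz]

/-- The flip at `j` reverses `σ_j`. [folklore] -/
theorem tcs_spinAt_flip {n : ℕ} (j : Fin n) (ω : SpinConfig (Fin n)) :
    spinAt j (fun z => if z = j then -ω z else ω z) = -spinAt j ω := by
  unfold spinAt
  dsimp only
  rw [if_pos rfl, Units.val_neg, Int.cast_neg]

/-- The pinned lift does not move the other spins: `σ_x(ω⁺) = σ_x(ω)` for `x ≠ j`. [folklore] -/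
theorem tcs_spinAt_update {n : ℕ} {j x : Fin n} (h : ¬ j = x) (ω : SpinConfig (Fin n)) :
    spinAt x (Function.update ω j 1) = spinAt x ω := by
  unfold spinAt
  rw [Function.update_of_ne (fun e => h e.symm)]

/-- The pinned spin is `+1`: `σ_j(ω⁺) = 1`. [folklore] -/
theorem tcs_spinAt_update_self {n : ℕ} (j : Fin n) (ω : SpinConfig (Fin n)) :
    spinAt j (Function.update ω j 1) = 1 := by
  unfold spinAt
  rw [Function.update_self, Units.val_one, Int.cast_one]

/-- The odd part of a lifted sum vanishes: `∑_ω σ_j G(ω⁺) = 0`, by the flip at `j`, which reverses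
`σ_j` and fixes `ω⁺`. [folklore] -/
theorem tcs_sum_odd_update {n : ℕ} (j : Fin n) (G : SpinConfig (Fin n) → ℝ) :
    ∑ ω : SpinConfig (Fin n), spinAt j ω * G (Function.update ω j 1) = 0 := by
  obtain ⟨g, hg⟩ : ∃ g : SpinConfig (Fin n) → ℝ,
      ∀ ω, g ω = spinAt j ω * G (Function.update ω j 1) := ⟨_, fun _ => rfl⟩
  have hodd : ∀ ω : SpinConfig (Fin n), g (fun z => if z = j then -ω z else ω z) = -g ω := by
    intro ω
    rw [hg, hg, tcs_update_flip j ω, tcs_spinAt_flip j ω]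
    ring
  have hsum := ccc_sum_flip j g
  rw [Finset.sum_congr rfl fun ω _ => hodd ω, Finset.sum_neg_distrib] at hsum
  have h0 : ∑ ω, g ω = 0 := by linarith
  rw [← h0]
  exact Finset.sum_congr rfl fun ω _ => (hg ω).symm

/-- Pointwise, the weight `1 + σ_j` identifies `ω` with its lift:
`(1 + σ_j)G(ω⁺) = (1 + σ_j)G(ω)` (the weight vanishes unless `ω j = 1`, where `ω⁺ = ω`). [folklore] -/
theorem tcs_proj_update {n : ℕ} (j : Fin n) (ω : SpinConfig (Fin n)) (G : SpinConfig (Fin n) → ℝ) :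
    (1 + spinAt j ω) * G (Function.update ω j 1) = (1 + spinAt j ω) * G ω := by
  by_cases h : ω j = 1
  · have e : Function.update ω j 1 = ω := by
      rw [← h]
      exact Function.update_eq_self j ω
    rw [e]
  · have h0 : 1 + spinAt j ω = 0 := by
      unfold spinAt
      rcases Int.units_eq_one_or (ω j) with hu | hu
      · exact absurd hu h
      · rw [hu]
        norm_num
    rw [h0, zero_mul, zero_mul]

/-- **Lift = conditioning on `σ_j = 1`.**  `∑_ω G(ω⁺) = ∑_ω (1 + σ_j) G(ω)`: the lift is two-to-one
onto the configurations with `σ_j = 1`. [folklore] -/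
theorem tcs_sum_update {n : ℕ} (j : Fin n) (G : SpinConfig (Fin n) → ℝ) :
    ∑ ω : SpinConfig (Fin n), G (Function.update ω j 1) = ∑ ω, (1 + spinAt j ω) * G ω := by
  have h1 : ∀ ω : SpinConfig (Fin n), G (Function.update ω j 1) =
      (1 + spinAt j ω) * G (Function.update ω j 1) - spinAt j ω * G (Function.update ω j 1) :=
    fun ω => by ring
  rw [Finset.sum_congr rfl fun ω _ => h1 ω, Finset.sum_sub_distrib, tcs_sum_odd_update j G, sub_zero]
  exact Finset.sum_congr rfl fun ω _ => tcs_proj_update j ω G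

/-- `1 + σ_j = 2 · 1[σ_j = 1]`. [folklore] -/
theorem tcs_one_add_spinAt {n : ℕ} (j : Fin n) (ω : SpinConfig (Fin n)) :
    1 + spinAt j ω = 2 * (if spinAt j ω = 1 then 1 else 0) := by
  rcases spinAt_eq_one_or_eq_neg_one j ω with h | h <;> rw [h] <;> norm_num

/-! ## The pinned system: `j` erased from every support -/

/-- `σ_{A ∖ {j}}(ω) = σ_A(ω⁺)`. [folklore] -/
theorem tcs_spinProduct_erase {n : ℕ} (j : Fin n) (A : Finset (Fin n)) (ω : SpinConfig (Fin n)) :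
    spinProduct (A.erase j) ω = spinProduct A (Function.update ω j 1) := by
  unfold spinProduct
  rw [← Finset.prod_erase A (f := fun x => spinAt x (Function.update ω j 1)) (a := j)
    (tcs_spinAt_update_self j ω)]
  refine Finset.prod_congr rfl fun x hx => ?_
  unfold spinAt
  rw [Function.update_of_ne (Finset.ne_of_mem_erase hx)]

/-- The pinned weight is the weight of the lift: `w'(ω) = w(ω⁺)` for `C' b = (C b).erase j`. [folklore] -/
theorem tcs_gksWeight_erase {n m : ℕ} (K : Fin m → ℝ) (C : Fin m → Finset (Fin n)) (j : Fin n)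
    (ω : SpinConfig (Fin n)) :
    gksWeight Finset.univ K (fun b => (C b).erase j) ω =
      gksWeight Finset.univ K C (Function.update ω j 1) := by
  unfold gksWeight gksHamiltonian
  congr 1
  exact Finset.sum_congr rfl fun b _ => by rw [tcs_spinProduct_erase]

/-- **Pinned sums are twice the clamped sums.**  For an observable `F` not depending on `σ_j`,
`∑_σ F w' = 2 ∑_σ 1[σ_j = 1] F w`. [folklore] -/
theorem tcs_gksSum_erase_lift {n m : ℕ} (K : Fin m → ℝ) (C : Fin m → Finset (Fin n)) (j : Fin n)
    (F : SpinConfig (Fin n) → ℝ) (hF : ∀ ω, F (Function.update ω j 1) = F ω) :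
    gksSum Finset.univ K (fun b => (C b).erase j) F =
      2 * gksSum Finset.univ K C (fun ω => (if spinAt j ω = 1 then 1 else 0) * F ω) := by
  unfold gksSum
  have e1 : ∀ ω : SpinConfig (Fin n), F ω * gksWeight Finset.univ K (fun b => (C b).erase j) ω =
      F (Function.update ω j 1) * gksWeight Finset.univ K C (Function.update ω j 1) := fun ω => by
    rw [hF, tcs_gksWeight_erase]
  rw [Finset.sum_congr rfl fun ω _ => e1 ω,
    tcs_sum_update j (fun ω' => F ω' * gksWeight Finset.univ K C ω'), Finset.mul_sum]
  refine Finset.sum_congr rfl fun ω _ => ?_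
  show (1 + spinAt j ω) * (F ω * gksWeight Finset.univ K C ω) =
    2 * ((if spinAt j ω = 1 then 1 else 0) * F ω * gksWeight Finset.univ K C ω)
  rw [tcs_one_add_spinAt]
  ring

/-- Clamp indicators: `1[σ_j = 1] · 1[A ∧ B] = 1[A ∧ σ_j = 1 ∧ B]`. [folklore] -/
theorem tcs_ite_mul_ite {n : ℕ} (j : Fin n) (ω : SpinConfig (Fin n)) (A B : Prop) [Decidable A]
    [Decidable B] :
    (if spinAt j ω = 1 then (1 : ℝ) else 0) * (if A ∧ B then 1 else 0) =
      if A ∧ spinAt j ω = 1 ∧ B then 1 else 0 := by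
  by_cases hj : spinAt j ω = 1
  · by_cases hA : A <;> by_cases hB : B <;> simp [hj, hA, hB]
  · by_cases hA : A <;> by_cases hB : B <;> simp [hj, hA, hB]

/-- The one-clamp restricted sums `Z'_{st}` of the pinned system are twice the two-clamp restricted
sums `Z_{st}` (`j ∉ {i, k, l}`). [folklore] -/
theorem tcs_Z_eq {n m : ℕ} (K : Fin m → ℝ) (C : Fin m → Finset (Fin n)) {i j k l : Fin n}
    (hji : ¬ j = i) (hjk : ¬ j = k) (hjl : ¬ j = l) (s t : ℝ) :
    gksSum Finset.univ K (fun b => (C b).erase j)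
        (fun σ => if spinAt i σ = 1 ∧ spinAt k σ = s ∧ spinAt l σ = t then 1 else 0) =
      2 * gksSum Finset.univ K C
        (fun σ => if spinAt i σ = 1 ∧ spinAt j σ = 1 ∧ spinAt k σ = s ∧ spinAt l σ = t then 1 else 0) := by
  rw [tcs_gksSum_erase_lift K C j _ fun ω => by
    simp only [tcs_spinAt_update hji, tcs_spinAt_update hjk, tcs_spinAt_update hjl]]
  congr 1
  unfold gksSum
  refine Finset.sum_congr rfl fun ω _ => ?_
  dsimp only
  rw [tcs_ite_mul_ite]

/-- The same for the sums `N'_{st} = 2 N_{st}` carrying the observable `σ_g` (`j ∉ {i, k, l, g}`). [folklore] -/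
theorem tcs_N_eq {n m : ℕ} (K : Fin m → ℝ) (C : Fin m → Finset (Fin n)) {g i j k l : Fin n}
    (hji : ¬ j = i) (hjk : ¬ j = k) (hjl : ¬ j = l) (hjg : ¬ j = g) (s t : ℝ) :
    gksSum Finset.univ K (fun b => (C b).erase j)
        (fun σ => (if spinAt i σ = 1 ∧ spinAt k σ = s ∧ spinAt l σ = t then 1 else 0) * spinAt g σ) =
      2 * gksSum Finset.univ K C
        (fun σ => (if spinAt i σ = 1 ∧ spinAt j σ = 1 ∧ spinAt k σ = s ∧ spinAt l σ = t then 1 else 0) *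
          spinAt g σ) := by
  rw [tcs_gksSum_erase_lift K C j _ fun ω => by
    simp only [tcs_spinAt_update hji, tcs_spinAt_update hjk, tcs_spinAt_update hjl,
      tcs_spinAt_update hjg]]
  congr 1
  unfold gksSum
  refine Finset.sum_congr rfl fun ω _ => ?_
  dsimp only
  rw [← mul_assoc, tcs_ite_mul_ite]

/-! ## Degenerate coincidences `j ∈ {k, l, g}` -/

/-- An incompatible double clamp at one site (adjacent clauses) is empty. [folklore] -/
theorem tcs_ite_contra {n : ℕ} (x : Fin n) (σ : SpinConfig (Fin n)) (A B : Prop)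
    [Decidable (A ∧ spinAt x σ = 1 ∧ spinAt x σ = -1 ∧ B)] :
    (if A ∧ spinAt x σ = 1 ∧ spinAt x σ = -1 ∧ B then (1 : ℝ) else 0) = 0 := by
  rw [if_neg]
  rintro ⟨_, h1, h2, _⟩
  rw [h1] at h2
  norm_num at h2

/-- An incompatible double clamp at one site (separated clauses) is empty. [folklore] -/
theorem tcs_ite_contra' {n : ℕ} (x : Fin n) (σ : SpinConfig (Fin n)) (A B : Prop)
    [Decidable (A ∧ spinAt x σ = 1 ∧ B ∧ spinAt x σ = -1)] :
    (if A ∧ spinAt x σ = 1 ∧ B ∧ spinAt x σ = -1 then (1 : ℝ) else 0) = 0 := by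
  rw [if_neg]
  rintro ⟨_, h1, _, h2⟩
  rw [h1] at h2
  norm_num at h2

/-- On a clamp `σ_x = 1` the observable `σ_x` is `1`. [folklore] -/
theorem tcs_ite_mul_spinAt {n : ℕ} (x : Fin n) (σ : SpinConfig (Fin n)) (A B : Prop)
    [Decidable (A ∧ spinAt x σ = 1 ∧ B)] :
    (if A ∧ spinAt x σ = 1 ∧ B then (1 : ℝ) else 0) * spinAt x σ =
      if A ∧ spinAt x σ = 1 ∧ B then 1 else 0 := by
  split_ifs with h
  · rw [h.2.1, mul_one]
  · exact zero_mul _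

/-- The unnormalised expectation of `0` is `0`. [folklore] -/
theorem tcs_gksSum_zero {n m : ℕ} (K : Fin m → ℝ) (C : Fin m → Finset (Fin n)) :
    gksSum Finset.univ K C (fun _ => 0) = 0 := by
  simp [gksSum]

/-- Transfer of the four-term inequality along `Z' = 2Z`, `N' = 2N` (both sides scale by `2⁴`). [folklore] -/
theorem tcs_transfer {Z₁ Z₂ Z₃ Z₄ N₁ N₂ N₃ N₄ Z₁' Z₂' Z₃' Z₄' N₁' N₂' N₃' N₄' : ℝ}
    (h : N₁' * Z₂' * Z₃' * Z₄' + Z₁' * N₂' * Z₃' * Z₄' ≤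
      Z₁' * Z₂' * N₃' * Z₄' + Z₁' * Z₂' * Z₃' * N₄')
    (hZ₁ : Z₁' = 2 * Z₁) (hZ₂ : Z₂' = 2 * Z₂) (hZ₃ : Z₃' = 2 * Z₃) (hZ₄ : Z₄' = 2 * Z₄)
    (hN₁ : N₁' = 2 * N₁) (hN₂ : N₂' = 2 * N₂) (hN₃ : N₃' = 2 * N₃) (hN₄ : N₄' = 2 * N₄) :
    N₁ * Z₂ * Z₃ * Z₄ + Z₁ * N₂ * Z₃ * Z₄ ≤ Z₁ * Z₂ * N₃ * Z₄ + Z₁ * Z₂ * Z₃ * N₄ := by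
  subst hZ₁ hZ₂ hZ₃ hZ₄ hN₁ hN₂ hN₃ hN₄
  linarith

/-! ## The theorem -/

/-- **K2 · second difference of the two-clamp conditional magnetisation.**  For the spin system
`ν_{Λ;K}` on `Fin n` with couplings `Kᵢ ≥ 0` on supports of at most two sites and any sites
`g i j k l`, in terms of the restricted sums `Z_{st} = ∑_σ 1[σ_i = σ_j = 1, σ_k = s, σ_l = t] w(σ)` and
`N_{st} = ∑_σ 1[σ_i = σ_j = 1, σ_k = s, σ_l = t] σ_g w(σ)`:
`N_{++}Z_{--}Z_{+-}Z_{-+} + Z_{++}N_{--}Z_{+-}Z_{-+} ≤ Z_{++}Z_{--}N_{+-}Z_{-+} + Z_{++}Z_{--}Z_{+-}N_{-+}`, i.e.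
`m(+,+,+,+) + m(+,+,-,-) ≤ m(+,+,+,-) + m(+,+,-,+)` for `m(s) = ⟨σ_g | (σ_i,σ_j,σ_k,σ_l) = s⟩`. [folklore] -/
theorem helper_twoClamp_secondDiff_nonpos :
    ∀ (n m : ℕ) (K : Fin m → ℝ) (C : Fin m → Finset (Fin n)), (∀ i, 0 ≤ K i) → (∀ i, (C i).card ≤ 2) →
      ∀ g i j k l : Fin n,
        gksSum Finset.univ K C (fun σ => (if spinAt i σ = 1 ∧ spinAt j σ = 1 ∧ spinAt k σ = 1 ∧ spinAt l σ = 1 then 1 else 0) * spinAt g σ) *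
            gksSum Finset.univ K C (fun σ => if spinAt i σ = 1 ∧ spinAt j σ = 1 ∧ spinAt k σ = -1 ∧ spinAt l σ = -1 then 1 else 0) *
            gksSum Finset.univ K C (fun σ => if spinAt i σ = 1 ∧ spinAt j σ = 1 ∧ spinAt k σ = 1 ∧ spinAt l σ = -1 then 1 else 0) *
            gksSum Finset.univ K C (fun σ => if spinAt i σ = 1 ∧ spinAt j σ = 1 ∧ spinAt k σ = -1 ∧ spinAt l σ = 1 then 1 else 0) +
          gksSum Finset.univ K C (fun σ => if spinAt i σ = 1 ∧ spinAt j σ = 1 ∧ spinAt k σ = 1 ∧ spinAt l σ = 1 then 1 else 0) *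
            gksSum Finset.univ K C (fun σ => (if spinAt i σ = 1 ∧ spinAt j σ = 1 ∧ spinAt k σ = -1 ∧ spinAt l σ = -1 then 1 else 0) * spinAt g σ) *
            gksSum Finset.univ K C (fun σ => if spinAt i σ = 1 ∧ spinAt j σ = 1 ∧ spinAt k σ = 1 ∧ spinAt l σ = -1 then 1 else 0) *
            gksSum Finset.univ K C (fun σ => if spinAt i σ = 1 ∧ spinAt j σ = 1 ∧ spinAt k σ = -1 ∧ spinAt l σ = 1 then 1 else 0) ≤
        gksSum Finset.univ K C (fun σ => if spinAt i σ = 1 ∧ spinAt j σ = 1 ∧ spinAt k σ = 1 ∧ spinAt l σ = 1 then 1 else 0) *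
            gksSum Finset.univ K C (fun σ => if spinAt i σ = 1 ∧ spinAt j σ = 1 ∧ spinAt k σ = -1 ∧ spinAt l σ = -1 then 1 else 0) *
            gksSum Finset.univ K C (fun σ => (if spinAt i σ = 1 ∧ spinAt j σ = 1 ∧ spinAt k σ = 1 ∧ spinAt l σ = -1 then 1 else 0) * spinAt g σ) *
            gksSum Finset.univ K C (fun σ => if spinAt i σ = 1 ∧ spinAt j σ = 1 ∧ spinAt k σ = -1 ∧ spinAt l σ = 1 then 1 else 0) +
          gksSum Finset.univ K C (fun σ => if spinAt i σ = 1 ∧ spinAt j σ = 1 ∧ spinAt k σ = 1 ∧ spinAt l σ = 1 then 1 else 0) *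
            gksSum Finset.univ K C (fun σ => if spinAt i σ = 1 ∧ spinAt j σ = 1 ∧ spinAt k σ = -1 ∧ spinAt l σ = -1 then 1 else 0) *
            gksSum Finset.univ K C (fun σ => if spinAt i σ = 1 ∧ spinAt j σ = 1 ∧ spinAt k σ = 1 ∧ spinAt l σ = -1 then 1 else 0) *
            gksSum Finset.univ K C (fun σ => (if spinAt i σ = 1 ∧ spinAt j σ = 1 ∧ spinAt k σ = -1 ∧ spinAt l σ = 1 then 1 else 0) * spinAt g σ) := by
  intro n m K C hK hC g i j k l
  by_cases hji : j = i
  · -- the double clamp at `i` is a single clamp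
    subst hji
    simp only [and_self_left]
    exact Summit.CriticalPhenomena.Ising3DConformalLimit.PrecisionLaplacianMoebiusLimitOfTwoPointLaw.stub_condCubicNonpos
      n m K C hK hC g _ k l
  by_cases hjk : j = k
  · -- the sums with `σ_k = -1` are empty
    subst hjk
    simp only [tcs_ite_contra, zero_mul, tcs_gksSum_zero, mul_zero, add_zero, le_refl]
  by_cases hjl : j = l
  · -- the sums with `σ_l = -1` are empty
    subst hjl
    simp only [tcs_ite_contra', zero_mul, tcs_gksSum_zero, mul_zero, add_zero, le_refl]
  by_cases hjg : j = g
  · -- `σ_g = 1` on the clamp: `N = Z`, equality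
    subst hjg
    simp only [tcs_ite_mul_spinAt, le_refl]
  -- generic case: pin the spin at `j`
  have hC' : ∀ b, ((fun b => (C b).erase j) b).card ≤ 2 := fun b =>
    (Finset.card_erase_le).trans (hC b)
  have h := Summit.CriticalPhenomena.Ising3DConformalLimit.PrecisionLaplacianMoebiusLimitOfTwoPointLaw.stub_condCubicNonpos
    n m K (fun b => (C b).erase j) hK hC' g i k l
  exact tcs_transfer h (tcs_Z_eq K C hji hjk hjl 1 1) (tcs_Z_eq K C hji hjk hjl (-1) (-1))
    (tcs_Z_eq K C hji hjk hjl 1 (-1)) (tcs_Z_eq K C hji hjk hjl (-1) 1)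
    (tcs_N_eq K C hji hjk hjl hjg 1 1) (tcs_N_eq K C hji hjk hjl hjg (-1) (-1))
    (tcs_N_eq K C hji hjk hjl hjg 1 (-1)) (tcs_N_eq K C hji hjk hjl hjg (-1) 1)

end

end Summit.CriticalPhenomena.Ising3DConformalLimit.Cruxes.InverseMFerromagnet.PartialCovarianceLadder
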